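import Summits.Ventures.PercRepro.C041TriDomTwoExitDel

/-!
# ROW C-041 — THE TWO-EXIT MARKLESS PIECE, III: THE FIBRE COUNT
(p6, gen 46; P6-TWOEXIT-LEAN.md §53 ADDENDUM 17)

**THE TWO-EXIT COUNT** (`dom_of_twoExit_count`), a statement about counting alone.  A «domination statement» on a
status is `∀ V up-set, #{V ∧ Src st} ≤ #{V ∧ Tgt st}` for two predicates `Src, Tgt` on (status, colouring).  Suppose
that, for the two edges `f₁ ≠ f₂`, the predicates of `st` are those of `st₁` on the colourings with `ω f₁ = ω f₂` and
those of `st₀` on the others, that the predicates of `st₁` ignore the colour of `f₁` and those of `st₀` the colours of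
`f₁, f₂`.  Then the domination statement on `st₀` and on `st₁` gives it on `st`.

PROOF.  Sort the colourings `merge o i` by the inside part `i ∈ {RR, RB, BR, BB}` of the two edges
(`card_filter_eq_sum_fibre` at `In2 f₁ f₂`, the four inside parts `ins f₁ f₂ p q`, `sum_InSupp_two`).
* THE MIXED FIBRES `RB`, `BR` (`fib2_mixed_le`): on the fibre of `i` the predicates of `st` are those of `st₀` on the
  outside part, so the statement on `st₀` at the up-set `fun ω => V (merge ω i)` bounds the fibre — both counts carry
  the factor `#InSupp` (`card_filter_outOnly`).
* THE SAME-COLOUR FIBRES `RR`, `BB` TOGETHER (`fib2_same_le`): the statement on `st₁` at the up-set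
  `U ω := V (merge ω (ins (ω f₂) (ω f₂)))` — the colour of `f₂` decides which of the two fibres the colouring is
  read in, and `f₁`'s colour is ignored — counts every `RR`- and `BB`-fibre exactly twice (`card_U_eq`).
No transport between fibres is needed: the two same-colour inside parts are comparable (`BB ≤ RR`), which is what makes
`U` an up-set.  The instances — CONJECTURE (STOCHASTIC DOMINATION) and THE SIBLING DOMINATION across a two-exit
markless piece — are `C041TriDomTwoExitDomination`.
-/

namespace PercRepro

namespace ZoneZ

namespace MultiExit

open ZoneData Finset

section Count

variable {E₁ : Type}

/-- Merging twice is merging once. -/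
theorem merge_merge_outer (In : E₁ → Prop) [DecidablePred In] (o i j : E₁ → Bool) :
    merge In (merge In o i) j = merge In o j := by
  funext e
  by_cases h : In e
  · rw [merge_of_in In _ _ h, merge_of_in In _ _ h]
  · rw [merge_of_not_in In _ _ h, merge_of_not_in In _ _ h, merge_of_not_in In _ _ h]

variable [DecidableEq E₁] (f₁ f₂ : E₁)

/-! ## The four inside parts of two edges -/

/-- The edge predicate of the two exits. -/
abbrev In2 : E₁ → Prop := fun e => e = f₁ ∨ e = f₂

/-- The inside colouring of the two exits with the colours `p` (on `f₁`) and `q` (on `f₂`). -/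
def ins (p q : Bool) : E₁ → Bool := fun e => if e = f₁ then p else if e = f₂ then q else false

/-- `ins` at the first exit. -/
theorem ins_f₁ (p q : Bool) : ins f₁ f₂ p q f₁ = p := by
  simp [ins]

/-- `ins` at the second exit. -/
theorem ins_f₂ (hne : f₁ ≠ f₂) (p q : Bool) : ins f₁ f₂ p q f₂ = q := by
  simp [ins, hne.symm]

/-- `ins` off the exits. -/
theorem ins_of_not_in {e : E₁} (he : ¬ In2 f₁ f₂ e) (p q : Bool) : ins f₁ f₂ p q e = false := by
  unfold ins
  rw [if_neg fun h => he (Or.inl h), if_neg fun h => he (Or.inr h)]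

/-- The merge with `ins p q` at the second exit. -/
theorem merge_ins_f₂ (hne : f₁ ≠ f₂) (o : E₁ → Bool) (p q : Bool) :
    merge (In2 f₁ f₂) o (ins f₁ f₂ p q) f₂ = q := by
  rw [merge_of_in (In2 f₁ f₂) _ _ (Or.inr rfl), ins_f₂ f₁ f₂ hne]

/-- The merge with `ins p q` at the first exit. -/
theorem merge_ins_f₁ (o : E₁ → Bool) (p q : Bool) : merge (In2 f₁ f₂) o (ins f₁ f₂ p q) f₁ = p := by
  rw [merge_of_in (In2 f₁ f₂) _ _ (Or.inl rfl), ins_f₁]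

/-- The merge with `ins p q` off the exits. -/
theorem merge_ins_of_not_in (o : E₁ → Bool) (p q : Bool) {e : E₁} (he : ¬ In2 f₁ f₂ e) :
    merge (In2 f₁ f₂) o (ins f₁ f₂ p q) e = o e :=
  merge_of_not_in (In2 f₁ f₂) _ _ he

/-- The four inside parts are distinct. -/
theorem ins_injective (hne : f₁ ≠ f₂) : Function.Injective fun pq : Bool × Bool => ins f₁ f₂ pq.1 pq.2 := by
  rintro ⟨p, q⟩ ⟨p', q'⟩ h
  have h1 := congrFun h f₁
  have h2 := congrFun h f₂
  simp only [ins_f₁, ins_f₂ f₁ f₂ hne] at h1 h2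
  rw [h1, h2]

variable [Fintype E₁]

/-- `ins` is an inside part. -/
theorem ins_mem_InSupp (p q : Bool) : ins f₁ f₂ p q ∈ InSupp (In2 f₁ f₂) := by
  unfold InSupp
  rw [Finset.mem_filter]
  exact ⟨Finset.mem_univ _, fun e he => ins_of_not_in f₁ f₂ he p q⟩

/-- The inside parts of two edges are exactly the four `ins`. -/
theorem InSupp_two :
    InSupp (In2 f₁ f₂) = Finset.image (fun pq : Bool × Bool => ins f₁ f₂ pq.1 pq.2) Finset.univ := by
  ext i
  rw [Finset.mem_image]
  constructor
  · intro hi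
    refine ⟨(i f₁, i f₂), Finset.mem_univ _, ?_⟩
    funext e
    unfold ins
    by_cases h1 : e = f₁
    · rw [if_pos h1, h1]
    · rw [if_neg h1]
      by_cases h2 : e = f₂
      · rw [if_pos h2, h2]
      · rw [if_neg h2]
        unfold InSupp at hi
        rw [Finset.mem_filter] at hi
        exact (hi.2 e fun h => h.elim h1 h2).symm
  · rintro ⟨pq, _, rfl⟩
    exact ins_mem_InSupp f₁ f₂ pq.1 pq.2

/-- A sum over the inside parts of two edges is the sum of its four values. -/
theorem sum_InSupp_two (hne : f₁ ≠ f₂) (g : (E₁ → Bool) → ℕ) :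
    ∑ i ∈ InSupp (In2 f₁ f₂), g i =
      g (ins f₁ f₂ true true) + g (ins f₁ f₂ true false) + g (ins f₁ f₂ false true) + g (ins f₁ f₂ false false) := by
  rw [InSupp_two f₁ f₂, Finset.sum_image fun x _ y _ h => ins_injective f₁ f₂ hne h, Fintype.sum_prod_type]
  simp only [Fintype.sum_bool]
  ring

/-! ## The fibre counts -/

open Classical in
/-- The number of outside parts `o` with `merge o i ∈ V` and `P (merge o i)`. -/
noncomputable def fib2 (V P : (E₁ → Bool) → Prop) (i : E₁ → Bool) : ℕ :=
  ((OutSupp (In2 f₁ f₂)).filter fun o => V (merge (In2 f₁ f₂) o i) ∧ P (merge (In2 f₁ f₂) o i)).card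

open Classical in
/-- A count over all colourings is the sum of the four fibre counts. -/
theorem card_eq_sum_fib2 (hne : f₁ ≠ f₂) (V P : (E₁ → Bool) → Prop) :
    (univ.filter fun ω => V ω ∧ P ω).card =
      fib2 f₁ f₂ V P (ins f₁ f₂ true true) + fib2 f₁ f₂ V P (ins f₁ f₂ true false) +
        fib2 f₁ f₂ V P (ins f₁ f₂ false true) + fib2 f₁ f₂ V P (ins f₁ f₂ false false) := by
  rw [card_filter_inst.trans (card_filter_eq_sum_fibre (In2 f₁ f₂) fun ω => V ω ∧ P ω), sum_InSupp_two f₁ f₂ hne]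
  unfold fib2
  rfl

open Classical in
/-- A count of `V (merge · i) ∧ P'` over all colourings, for an outside-only `P'` matching `P` on the fibre. -/
theorem card_fibre_eq_mul_fib2 (V P P' : (E₁ → Bool) → Prop) (i : E₁ → Bool)
    (hP' : ∀ ω, P' ω ↔ P' (outN (In2 f₁ f₂) ω))
    (hrel : ∀ o ∈ OutSupp (In2 f₁ f₂), P' o ↔ P (merge (In2 f₁ f₂) o i)) :
    (univ.filter fun ω => V (merge (In2 f₁ f₂) ω i) ∧ P' ω).card = (InSupp (In2 f₁ f₂)).card * fib2 f₁ f₂ V P i := by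
  rw [card_filter_inst.trans (card_filter_outOnly (In2 f₁ f₂) _ fun ω => ?_)]
  · unfold fib2
    congr 1
    exact card_filter_congr' fun o ho => and_congr_right fun _ => hrel o ho
  · rw [merge_outN_left]
    exact and_congr_right fun _ => hP' ω

end Count

/-! ## The two-exit count -/

section Main

variable {E₁ : Type} [DecidableEq E₁] {f₁ f₂ : E₁}
variable {Src Tgt : (E₁ → EStat) → (E₁ → Bool) → Prop} {st st₀ st₁ : E₁ → EStat}

/-- The inside part read off the colour of the second exit is monotone. -/
theorem leCol_ins_same {ω ω' : E₁ → Bool} (hle : LeCol ω ω') :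
    LeCol (ins f₁ f₂ (ω f₂) (ω f₂)) (ins f₁ f₂ (ω' f₂) (ω' f₂)) := by
  intro e he
  unfold ins at he ⊢
  by_cases h1 : e = f₁
  · rw [if_pos h1] at he ⊢
    exact hle f₂ he
  · rw [if_neg h1] at he ⊢
    by_cases h2 : e = f₂
    · rw [if_pos h2] at he ⊢
      exact hle f₂ he
    · rw [if_neg h2] at he
      exact absurd he (by decide)

/-- The up-set of the same-colour fibres: the colour of `f₂` decides the fibre. -/
theorem upSet_same {V : (E₁ → Bool) → Prop} (hV : UpSet V) :
    UpSet fun ω => V (merge (In2 f₁ f₂) ω (ins f₁ f₂ (ω f₂) (ω f₂))) := by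
  intro ω ω' hω hle
  refine hV _ _ hω fun e he => ?_
  have h1 := leCol_merge_left (In2 f₁ f₂) hle (ins f₁ f₂ (ω f₂) (ω f₂)) e he
  exact leCol_merge_right (In2 f₁ f₂) ω' (leCol_ins_same hle) e h1

variable [Fintype E₁]

open Classical in
/-- THE MIXED FIBRES: on a fibre whose two exits have different colours, the statement on `st₀` bounds the fibre. -/
theorem fib2_mixed_le (hne : f₁ ≠ f₂)
    (hdiff : ∀ ω, ω f₁ ≠ ω f₂ → (Src st ω ↔ Src st₀ ω) ∧ (Tgt st ω ↔ Tgt st₀ ω))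
    (hc₀ : ∀ ω ω', (∀ e, ¬ (e = f₁ ∨ e = f₂) → ω e = ω' e) → (Src st₀ ω ↔ Src st₀ ω') ∧ (Tgt st₀ ω ↔ Tgt st₀ ω'))
    (h₀ : ∀ V : (E₁ → Bool) → Prop, UpSet V →
      (univ.filter fun ω => V ω ∧ Src st₀ ω).card ≤ (univ.filter fun ω => V ω ∧ Tgt st₀ ω).card)
    {V : (E₁ → Bool) → Prop} (hV : UpSet V) {p q : Bool} (hpq : p ≠ q) :
    fib2 f₁ f₂ V (Src st) (ins f₁ f₂ p q) ≤ fib2 f₁ f₂ V (Tgt st) (ins f₁ f₂ p q) := by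
  have key := h₀ (fun ω => V (merge (In2 f₁ f₂) ω (ins f₁ f₂ p q))) (upSet_fibreOut _ hV _)
  have hout : ∀ ω : E₁ → Bool, ∀ e, ¬ (e = f₁ ∨ e = f₂) → ω e = outN (In2 f₁ f₂) ω e := by
    intro ω e he
    unfold outN
    rw [merge_of_not_in (In2 f₁ f₂) _ _ he]
  have hmerge : ∀ o : E₁ → Bool, ∀ e, ¬ (e = f₁ ∨ e = f₂) → merge (In2 f₁ f₂) o (ins f₁ f₂ p q) e = o e :=
    fun o e he => merge_ins_of_not_in f₁ f₂ o p q he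
  have hdiff' : ∀ o : E₁ → Bool, (merge (In2 f₁ f₂) o (ins f₁ f₂ p q)) f₁ ≠ (merge (In2 f₁ f₂) o (ins f₁ f₂ p q)) f₂ := by
    intro o
    rw [merge_ins_f₁, merge_ins_f₂ f₁ f₂ hne]
    exact hpq
  rw [card_fibre_eq_mul_fib2 f₁ f₂ V (Src st) (Src st₀) _ (fun ω => (hc₀ ω _ (hout ω)).1)
      (fun o _ => ((hc₀ o _ fun e he => (hmerge o e he).symm).1.trans (hdiff _ (hdiff' o)).1.symm)),
    card_fibre_eq_mul_fib2 f₁ f₂ V (Tgt st) (Tgt st₀) _ (fun ω => (hc₀ ω _ (hout ω)).2)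
      (fun o _ => ((hc₀ o _ fun e he => (hmerge o e he).symm).2.trans (hdiff _ (hdiff' o)).2.symm))] at key
  exact Nat.le_of_mul_le_mul_left key (card_InSupp_pos _)

open Classical in
/-- The count of the same-colour up-set against a predicate of `st₁` is twice the two same-colour fibre counts. -/
theorem card_U_eq (hne : f₁ ≠ f₂) (V P P' : (E₁ → Bool) → Prop)
    (hrel : ∀ o ∈ OutSupp (In2 f₁ f₂), ∀ p q : Bool,
      P' (merge (In2 f₁ f₂) o (ins f₁ f₂ p q)) ↔ P (merge (In2 f₁ f₂) o (ins f₁ f₂ q q))) :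
    (univ.filter fun ω => V (merge (In2 f₁ f₂) ω (ins f₁ f₂ (ω f₂) (ω f₂))) ∧ P' ω).card =
      2 * (fib2 f₁ f₂ V P (ins f₁ f₂ true true) + fib2 f₁ f₂ V P (ins f₁ f₂ false false)) := by
  have hterm : ∀ p q : Bool,
      ((OutSupp (In2 f₁ f₂)).filter fun o =>
        V (merge (In2 f₁ f₂) (merge (In2 f₁ f₂) o (ins f₁ f₂ p q))
            (ins f₁ f₂ ((merge (In2 f₁ f₂) o (ins f₁ f₂ p q)) f₂) ((merge (In2 f₁ f₂) o (ins f₁ f₂ p q)) f₂))) ∧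
          P' (merge (In2 f₁ f₂) o (ins f₁ f₂ p q))).card = fib2 f₁ f₂ V P (ins f₁ f₂ q q) := by
    intro p q
    unfold fib2
    refine card_filter_congr' fun o ho => ?_
    rw [merge_ins_f₂ f₁ f₂ hne, merge_merge_outer, hrel o ho p q]
  rw [card_filter_inst.trans (card_filter_eq_sum_fibre (In2 f₁ f₂) _), sum_InSupp_two f₁ f₂ hne]
  rw [hterm, hterm, hterm, hterm]
  ring

open Classical in
/-- THE SAME-COLOUR FIBRES: the statement on `st₁` bounds the two same-colour fibres together. -/
theorem fib2_same_le (hne : f₁ ≠ f₂)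
    (hsame : ∀ ω, ω f₁ = ω f₂ → (Src st ω ↔ Src st₁ ω) ∧ (Tgt st ω ↔ Tgt st₁ ω))
    (hc₁ : ∀ ω ω', (∀ e, e ≠ f₁ → ω e = ω' e) → (Src st₁ ω ↔ Src st₁ ω') ∧ (Tgt st₁ ω ↔ Tgt st₁ ω'))
    (h₁ : ∀ V : (E₁ → Bool) → Prop, UpSet V →
      (univ.filter fun ω => V ω ∧ Src st₁ ω).card ≤ (univ.filter fun ω => V ω ∧ Tgt st₁ ω).card)
    {V : (E₁ → Bool) → Prop} (hV : UpSet V) :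
    fib2 f₁ f₂ V (Src st) (ins f₁ f₂ true true) + fib2 f₁ f₂ V (Src st) (ins f₁ f₂ false false) ≤
      fib2 f₁ f₂ V (Tgt st) (ins f₁ f₂ true true) + fib2 f₁ f₂ V (Tgt st) (ins f₁ f₂ false false) := by
  have key := h₁ _ (upSet_same (f₁ := f₁) (f₂ := f₂) hV)
  have hagree : ∀ (o : E₁ → Bool) (p q : Bool), ∀ e, e ≠ f₁ →
      merge (In2 f₁ f₂) o (ins f₁ f₂ p q) e = merge (In2 f₁ f₂) o (ins f₁ f₂ q q) e := by
    intro o p q e he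
    by_cases h2 : e = f₂
    · rw [h2, merge_ins_f₂ f₁ f₂ hne, merge_ins_f₂ f₁ f₂ hne]
    · rw [merge_ins_of_not_in f₁ f₂ o p q fun h => h.elim he h2, merge_ins_of_not_in f₁ f₂ o q q fun h => h.elim he h2]
  have hsame' : ∀ (o : E₁ → Bool) (q : Bool),
      (merge (In2 f₁ f₂) o (ins f₁ f₂ q q)) f₁ = (merge (In2 f₁ f₂) o (ins f₁ f₂ q q)) f₂ := by
    intro o q
    rw [merge_ins_f₁, merge_ins_f₂ f₁ f₂ hne]
  rw [card_U_eq hne V (Src st) (Src st₁) fun o _ p q =>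
        (hc₁ _ _ (hagree o p q)).1.trans (hsame _ (hsame' o q)).1.symm,
    card_U_eq hne V (Tgt st) (Tgt st₁) fun o _ p q =>
        (hc₁ _ _ (hagree o p q)).2.trans (hsame _ (hsame' o q)).2.symm] at key
  omega

open Classical in
/-- **THE TWO-EXIT COUNT**: a domination statement on `st` follows from the same statement on `st₀` and on `st₁`
when the predicates of `st` are those of `st₁` on the colourings with `ω f₁ = ω f₂` and those of `st₀` otherwise,
the predicates of `st₁` ignore the colour of `f₁` and those of `st₀` the colours of `f₁, f₂`. -/
theorem dom_of_twoExit_count (hne : f₁ ≠ f₂)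
    (hsame : ∀ ω, ω f₁ = ω f₂ → (Src st ω ↔ Src st₁ ω) ∧ (Tgt st ω ↔ Tgt st₁ ω))
    (hdiff : ∀ ω, ω f₁ ≠ ω f₂ → (Src st ω ↔ Src st₀ ω) ∧ (Tgt st ω ↔ Tgt st₀ ω))
    (hc₁ : ∀ ω ω', (∀ e, e ≠ f₁ → ω e = ω' e) → (Src st₁ ω ↔ Src st₁ ω') ∧ (Tgt st₁ ω ↔ Tgt st₁ ω'))
    (hc₀ : ∀ ω ω', (∀ e, ¬ (e = f₁ ∨ e = f₂) → ω e = ω' e) → (Src st₀ ω ↔ Src st₀ ω') ∧ (Tgt st₀ ω ↔ Tgt st₀ ω'))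
    (h₀ : ∀ V : (E₁ → Bool) → Prop, UpSet V →
      (univ.filter fun ω => V ω ∧ Src st₀ ω).card ≤ (univ.filter fun ω => V ω ∧ Tgt st₀ ω).card)
    (h₁ : ∀ V : (E₁ → Bool) → Prop, UpSet V →
      (univ.filter fun ω => V ω ∧ Src st₁ ω).card ≤ (univ.filter fun ω => V ω ∧ Tgt st₁ ω).card)
    (V : (E₁ → Bool) → Prop) (hV : UpSet V) :
    (univ.filter fun ω => V ω ∧ Src st ω).card ≤ (univ.filter fun ω => V ω ∧ Tgt st ω).card := by
  rw [card_eq_sum_fib2 f₁ f₂ hne V (Src st), card_eq_sum_fib2 f₁ f₂ hne V (Tgt st)]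
  have hTF := fib2_mixed_le hne hdiff hc₀ h₀ hV (p := true) (q := false) (by decide)
  have hFT := fib2_mixed_le hne hdiff hc₀ h₀ hV (p := false) (q := true) (by decide)
  have hS := fib2_same_le hne hsame hc₁ h₁ hV
  omega

end Main

end MultiExit

end ZoneZ

end PercRepro
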